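import Mathlib
import Literature.Analysis.FluidPDE.VectorCalculus
import Literature.Analysis.FluidPDE.LeiZhang2011Proofs
import Summits.NavierStokesRegularity.NavierStokesRegularity.Theorems.FilamentSkeletonRssMatchedKernelDifferentiable

/-!
# The MATCHED-CORE regularised Biot–Savart field: explicit directional derivative
# (variable core `m(u) ≥ m₀ > 0` along the filament)

Sequel to `…Theorems.FilamentSkeletonRssMatchedKernelDifferentiable` (same hypotheses: core profile `m : ℝ → ℝ`
continuous with a floor `0 < m₀ ≤ m u`; `C¹` proper filament `X`, `‖X′‖ ≤ 1`, `c|u| − C ≤ ‖X u‖`).  For the field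
`F(y) = ∫ K₃(u; y − X u) • X′(u) × (y − X u) du`, `K₃(u; z) = ((‖z‖² + m u)^{3/2})⁻¹`, `K₅(u; z) = ((‖z‖² + m u)^{5/2})⁻¹`:

* `matchedBiotSavart_directionalDeriv` — at every `y`, in every direction `v`, the derivative integrand
  `(−3 ⟨y − X u, v⟩ K₅) • X′(u) × (y − X u) + K₃ • X′(u) × v` is Bochner integrable and is the derivative of
  `s ↦ F(y + s v)` at `s = 0` (one-dimensional differentiation under the integral sign on `|s| < 1`, dominated by a
  multiple of `(1 + u²)⁻¹`);
* `matchedBiotSavart_fderiv_apply_eq` — hence `fderiv F y v` IS that integral (uniqueness of the derivative along the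
  line, with `…MatchedKernelDifferentiable.matchedBiotSavart_differentiable`).

Port of the constant-core `…SkeletonEquilibriumBiotSavartDirectionalDeriv.lean` and of
`SelectionBoxRJRung.biotSavart_fderiv_apply_eq` (`…RungPartnerStrain`) with `e² ↦ m u` pointwise and `e² ↦ m₀` in the
dominations (kit `retype_R-T_kit.md` §5(d) μ-parametrised restatements).  Lane ns-filament-19175-p1 g11;
`--supports stmt-NavierStokesRegularity-27849`.  HONEST FRAMING: calculus for a HYPOTHETICAL filament skeleton on the
NEGATIVE side of a MODEL route; nothing here bears on Navier–Stokes regularity or blow-up.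
-/

noncomputable section

open MeasureTheory Filter Topology
open Literature.Analysis.FluidPDE
open scoped InnerProductSpace

namespace Summit.NavierStokesRegularity.NavierStokesRegularity.Theorems.MatchedKernel
set_option linter.dupNamespace false

/-! ### Calculus along the line `s ↦ y + s • v` with a positive core constant `q` -/

/-- The affine line `s ↦ y + s • v − b` has velocity `v`. [folklore] -/
theorem hasDerivAt_line_sub (y v b : EuclideanSpace ℝ (Fin 3)) (s : ℝ) :
    HasDerivAt (fun s : ℝ => y + s • v - b) v s :=
  ((((hasDerivAt_id' (x := s)).smul_const v).const_add y).sub_const b).congr_deriv (one_smul _ _)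

/-- `s ↦ a × (y + s • v − b)` has derivative `a × v`. [folklore] -/
theorem hasDerivAt_cross_line (a y v b : EuclideanSpace ℝ (Fin 3)) (s : ℝ) :
    HasDerivAt (fun s : ℝ => cross a (y + s • v - b)) (cross a v) s := by
  have h := (crossCLM a).hasFDerivAt.comp_hasDerivAt s (hasDerivAt_line_sub y v b s)
  simpa [Function.comp_def] using h

/-- The kernel along the line, `s ↦ ((‖y + s v − b‖² + q)^{3/2})⁻¹` (`q > 0`), has derivative
`−3 ⟨y + s v − b, v⟩ ((‖y + s v − b‖² + q)^{5/2})⁻¹`. [folklore] -/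
theorem kernel_hasDerivAt_line {q : ℝ} (hq : 0 < q) (y v b : EuclideanSpace ℝ (Fin 3)) (s : ℝ) :
    HasDerivAt (fun s : ℝ => ((‖y + s • v - b‖ ^ 2 + q) ^ (3 / 2 : ℝ))⁻¹)
      (-3 * inner ℝ (y + s • v - b) v * ((‖y + s • v - b‖ ^ 2 + q) ^ (5 / 2 : ℝ))⁻¹) s := by
  have hpos : ∀ z : EuclideanSpace ℝ (Fin 3), 0 < ‖z‖ ^ 2 + q := fun z => by positivity
  have h1 : HasDerivAt (fun s : ℝ => ‖y + s • v - b‖ ^ 2 + q) (2 * inner ℝ (y + s • v - b) v) s :=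
    (hasDerivAt_line_sub y v b s).norm_sq.add_const _
  have h2 := h1.rpow_const (p := -(3 / 2)) (Or.inl (hpos _).ne')
  have hfun : (fun s : ℝ => ((‖y + s • v - b‖ ^ 2 + q) ^ (3 / 2 : ℝ))⁻¹)
      = fun s => (‖y + s • v - b‖ ^ 2 + q) ^ (-(3 / 2) : ℝ) := by
    funext s
    rw [Real.rpow_neg (hpos _).le]
  rw [hfun]
  refine h2.congr_deriv ?_
  rw [show (-(3 / 2) : ℝ) - 1 = -(5 / 2) by norm_num, Real.rpow_neg (hpos _).le]
  ring

/-- Product rule along the line for the integrand `K₃(y + s v − b) • a × (y + s v − b)` (`q > 0`). [folklore] -/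
theorem integrand_hasDerivAt_line {q : ℝ} (hq : 0 < q) (a y v b : EuclideanSpace ℝ (Fin 3)) (s : ℝ) :
    HasDerivAt (fun s : ℝ => ((‖y + s • v - b‖ ^ 2 + q) ^ (3 / 2 : ℝ))⁻¹ • cross a (y + s • v - b))
      ((-3 * inner ℝ (y + s • v - b) v * ((‖y + s • v - b‖ ^ 2 + q) ^ (5 / 2 : ℝ))⁻¹) •
          cross a (y + s • v - b) +
        ((‖y + s • v - b‖ ^ 2 + q) ^ (3 / 2 : ℝ))⁻¹ • cross a v) s :=
  ((kernel_hasDerivAt_line hq y v b s).smul (hasDerivAt_cross_line a y v b s)).congr_deriv (add_comm _ _)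

/-- Pointwise bound on the `s`-derivative of the integrand:
`‖(−3 ⟨w, v⟩ K₅(w)) • a × w + K₃(w) • a × v‖ ≤ 4 (√q)⁻¹ (‖w‖² + q)⁻¹ ‖v‖` for `‖a‖ ≤ 1`, `q > 0`. [folklore] -/
theorem norm_deriv_integrand_le {q : ℝ} (hq : 0 < q) (a w v : EuclideanSpace ℝ (Fin 3)) (ha : ‖a‖ ≤ 1) :
    ‖(-3 * inner ℝ w v * ((‖w‖ ^ 2 + q) ^ (5 / 2 : ℝ))⁻¹) • cross a w + ((‖w‖ ^ 2 + q) ^ (3 / 2 : ℝ))⁻¹ • cross a v‖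
      ≤ 4 * (Real.sqrt q)⁻¹ * (‖w‖ ^ 2 + q)⁻¹ * ‖v‖ := by
  set σ := ‖w‖ ^ 2 + q with hσ_def
  have hσ0 : 0 < σ := by positivity
  have hqσ : q ≤ σ := le_add_of_nonneg_left (sq_nonneg _)
  have hwσ : ‖w‖ ^ 2 ≤ σ := le_add_of_nonneg_right hq.le
  have hk3 : (σ ^ (3 / 2 : ℝ))⁻¹ = σ ^ (-(3 / 2) : ℝ) := (Real.rpow_neg hσ0.le _).symm
  have hk5 : (σ ^ (5 / 2 : ℝ))⁻¹ = σ ^ (-(5 / 2) : ℝ) := (Real.rpow_neg hσ0.le _).symm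
  have hcw : ‖cross a w‖ ≤ ‖w‖ :=
    (norm_cross_le_norm_mul_norm a w).trans (mul_le_of_le_one_left (norm_nonneg _) ha)
  have hcv : ‖cross a v‖ ≤ ‖v‖ :=
    (norm_cross_le_norm_mul_norm a v).trans (mul_le_of_le_one_left (norm_nonneg _) ha)
  have hi : |inner ℝ w v| ≤ ‖w‖ * ‖v‖ := abs_real_inner_le_norm w v
  have h1 : ‖(-3 * inner ℝ w v * (σ ^ (5 / 2 : ℝ))⁻¹) • cross a w‖ ≤ 3 * σ ^ (-(3 / 2) : ℝ) * ‖v‖ := by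
    rw [norm_smul, hk5, Real.norm_eq_abs, abs_mul, abs_mul, abs_neg, abs_of_pos (by norm_num : (0 : ℝ) < 3),
      abs_of_nonneg (Real.rpow_nonneg hσ0.le _)]
    calc 3 * |inner ℝ w v| * σ ^ (-(5 / 2) : ℝ) * ‖cross a w‖
        ≤ 3 * (‖w‖ * ‖v‖) * σ ^ (-(5 / 2) : ℝ) * ‖w‖ := mul_le_mul (by gcongr) hcw (norm_nonneg _) (by positivity)
      _ = 3 * (σ ^ (-(5 / 2) : ℝ) * ‖w‖ ^ 2) * ‖v‖ := by ring
      _ ≤ 3 * (σ ^ (-(5 / 2) : ℝ) * σ) * ‖v‖ := by gcongr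
      _ = 3 * σ ^ (-(3 / 2) : ℝ) * ‖v‖ := by
          rw [show (-(3 / 2) : ℝ) = -(5 / 2) + 1 by norm_num, Real.rpow_add_one hσ0.ne']
  have h2 : ‖(σ ^ (3 / 2 : ℝ))⁻¹ • cross a v‖ ≤ σ ^ (-(3 / 2) : ℝ) * ‖v‖ := by
    rw [norm_smul, hk3, Real.norm_of_nonneg (Real.rpow_nonneg hσ0.le _)]
    exact mul_le_mul_of_nonneg_left hcv (Real.rpow_nonneg hσ0.le _)
  calc _ ≤ _ := norm_add_le _ _
    _ ≤ 3 * σ ^ (-(3 / 2) : ℝ) * ‖v‖ + σ ^ (-(3 / 2) : ℝ) * ‖v‖ := add_le_add h1 h2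
    _ = 4 * σ ^ (-(3 / 2) : ℝ) * ‖v‖ := by ring
    _ ≤ 4 * ((Real.sqrt q)⁻¹ * σ⁻¹) * ‖v‖ := by
        gcongr
        exact rpow_neg_three_halves_le hq hqσ
    _ = 4 * (Real.sqrt q)⁻¹ * σ⁻¹ * ‖v‖ := by ring

/-! ### Dominations and continuity with a core profile `m ≥ m₀ > 0` -/

/-- Uniform domination near `y`: for `‖z − y‖ ≤ R` (`R ≥ 0`), `(‖z − X u‖² + m u)⁻¹ ≤ M (1 + u²)⁻¹` with
`M = (4m₀ + c² + 4D²)/(c² m₀)`, `D = |C| + ‖y‖ + R + 1`. [folklore] -/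
theorem inv_le_of_norm_sub_le {m : ℝ → ℝ} {m₀ c C R : ℝ} {X : ℝ → EuclideanSpace ℝ (Fin 3)}
    (hm₀ : 0 < m₀) (hm : ∀ u, m₀ ≤ m u) (hc : 0 < c) (hXg : ∀ u, c * |u| - C ≤ ‖X u‖) (hR : 0 ≤ R)
    (y : EuclideanSpace ℝ (Fin 3)) {z : EuclideanSpace ℝ (Fin 3)} (hz : ‖z - y‖ ≤ R) (u : ℝ) :
    (‖z - X u‖ ^ 2 + m u)⁻¹ ≤ (4 * m₀ + c ^ 2 + 4 * (|C| + ‖y‖ + R + 1) ^ 2) / (c ^ 2 * m₀) * (1 + u ^ 2)⁻¹ := by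
  have hD : 0 < |C| + ‖y‖ + R + 1 := by positivity
  have hr : c * |u| - (|C| + ‖y‖ + R + 1) ≤ ‖z - X u‖ := by
    have h1 := norm_sub_norm_le (X u) z
    have h2 := norm_le_norm_add_norm_sub' z y
    have h3 := hXg u
    have h4 := le_abs_self C
    rw [norm_sub_rev] at h1
    linarith
  have key := one_add_sq_le hc hD (norm_nonneg _) (abs_nonneg u) hm₀ hr
  rw [sq_abs] at key
  have hσ1 : 0 < ‖z - X u‖ ^ 2 + m₀ := by positivity
  have hmono : (‖z - X u‖ ^ 2 + m u)⁻¹ ≤ (‖z - X u‖ ^ 2 + m₀)⁻¹ := inv_anti₀ hσ1 (by linarith [hm u])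
  refine hmono.trans ?_
  have h1u : 0 < 1 + u ^ 2 := by positivity
  rw [← div_eq_mul_inv, le_div_iff₀ h1u, inv_mul_le_iff₀ hσ1]
  linarith [mul_comm ((4 * m₀ + c ^ 2 + 4 * (|C| + ‖y‖ + R + 1) ^ 2) / (c ^ 2 * m₀)) (‖z - X u‖ ^ 2 + m₀)]

/-- Continuity in `u` of the kernels `u ↦ ((‖z − X u‖² + m u)^p)⁻¹` (`m` continuous, `m ≥ m₀ > 0`). [folklore] -/
theorem continuous_kernel {m : ℝ → ℝ} {m₀ : ℝ} (hm₀ : 0 < m₀) (hm : ∀ u, m₀ ≤ m u) (hmc : Continuous m)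
    {X : ℝ → EuclideanSpace ℝ (Fin 3)} (hXc : Continuous X) (z : EuclideanSpace ℝ (Fin 3)) (p : ℝ) :
    Continuous (fun u : ℝ => ((‖z - X u‖ ^ 2 + m u) ^ p)⁻¹) := by
  have hpos : ∀ u, (0 : ℝ) < ‖z - X u‖ ^ 2 + m u := fun u =>
    add_pos_of_nonneg_of_pos (sq_nonneg _) (hm₀.trans_le (hm u))
  exact ((((continuous_const.sub hXc).norm.pow 2).add hmc).rpow_const
    fun u => Or.inl (hpos u).ne').inv₀ fun u => (Real.rpow_pos_of_pos (hpos u) _).ne'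

/-- Continuity in `u` of the matched-core integrand at a fixed point `z`. [folklore] -/
theorem continuous_integrand_at {m : ℝ → ℝ} {m₀ : ℝ} (hm₀ : 0 < m₀) (hm : ∀ u, m₀ ≤ m u) (hmc : Continuous m)
    {X : ℝ → EuclideanSpace ℝ (Fin 3)} (hX : ContDiff ℝ 1 X) (z : EuclideanSpace ℝ (Fin 3)) :
    Continuous (fun u : ℝ => ((‖z - X u‖ ^ 2 + m u) ^ (3 / 2 : ℝ))⁻¹ • cross (deriv X u) (z - X u)) := by
  have hXc : Continuous X := hX.continuous
  have hX'c : Continuous (deriv X) := hX.continuous_deriv le_rfl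
  have hcr : Continuous (fun u => cross (deriv X u) (z - X u)) :=
    (crossCLM.continuous.comp hX'c).clm_apply (continuous_const.sub hXc)
  exact (continuous_kernel hm₀ hm hmc hXc z _).smul hcr

/-- Continuity in `u` of the derivative integrand at a fixed point `z` and direction `v`. [folklore] -/
theorem continuous_deriv_integrand_at {m : ℝ → ℝ} {m₀ : ℝ} (hm₀ : 0 < m₀) (hm : ∀ u, m₀ ≤ m u)
    (hmc : Continuous m) {X : ℝ → EuclideanSpace ℝ (Fin 3)} (hX : ContDiff ℝ 1 X) (z v : EuclideanSpace ℝ (Fin 3)) :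
    Continuous (fun u : ℝ =>
      (-3 * inner ℝ (z - X u) v * ((‖z - X u‖ ^ 2 + m u) ^ (5 / 2 : ℝ))⁻¹) • cross (deriv X u) (z - X u) +
        ((‖z - X u‖ ^ 2 + m u) ^ (3 / 2 : ℝ))⁻¹ • cross (deriv X u) v) := by
  have hXc : Continuous X := hX.continuous
  have hX'c : Continuous (deriv X) := hX.continuous_deriv le_rfl
  have hv : Continuous (fun u : ℝ => z - X u) := continuous_const.sub hXc
  have hcr : Continuous (fun u => cross (deriv X u) (z - X u)) := (crossCLM.continuous.comp hX'c).clm_apply hv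
  have hcv : Continuous (fun u => cross (deriv X u) v) := (crossCLM.continuous.comp hX'c).clm_apply continuous_const
  exact (((continuous_const.mul (hv.inner continuous_const)).mul
    (continuous_kernel hm₀ hm hmc hXc z _)).smul hcr).add ((continuous_kernel hm₀ hm hmc hXc z _).smul hcv)

/-! ### The directional derivative -/

/-- Differentiation under the integral sign along the line `s ↦ y + s • v` at `s = 0` (point written `y + 0 • v`).
[folklore] -/
theorem directionalDeriv_key {m : ℝ → ℝ} {m₀ c C : ℝ} {X : ℝ → EuclideanSpace ℝ (Fin 3)}
    (hm₀ : 0 < m₀) (hm : ∀ u, m₀ ≤ m u) (hmc : Continuous m) (hc : 0 < c) (hX : ContDiff ℝ 1 X)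
    (hX1 : ∀ u, ‖deriv X u‖ ≤ 1) (hXg : ∀ u, c * |u| - C ≤ ‖X u‖) (y v : EuclideanSpace ℝ (Fin 3)) :
    Integrable (fun u : ℝ =>
        (-3 * inner ℝ (y + (0 : ℝ) • v - X u) v * ((‖y + (0 : ℝ) • v - X u‖ ^ 2 + m u) ^ (5 / 2 : ℝ))⁻¹) •
            cross (deriv X u) (y + (0 : ℝ) • v - X u) +
          ((‖y + (0 : ℝ) • v - X u‖ ^ 2 + m u) ^ (3 / 2 : ℝ))⁻¹ • cross (deriv X u) v) ∧
      HasDerivAt (fun s : ℝ => ∫ u : ℝ,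
          ((‖y + s • v - X u‖ ^ 2 + m u) ^ (3 / 2 : ℝ))⁻¹ • cross (deriv X u) (y + s • v - X u))
        (∫ u : ℝ,
          (-3 * inner ℝ (y + (0 : ℝ) • v - X u) v * ((‖y + (0 : ℝ) • v - X u‖ ^ 2 + m u) ^ (5 / 2 : ℝ))⁻¹) •
              cross (deriv X u) (y + (0 : ℝ) • v - X u) +
            ((‖y + (0 : ℝ) • v - X u‖ ^ 2 + m u) ^ (3 / 2 : ℝ))⁻¹ • cross (deriv X u) v) 0 := by
  set M : ℝ := (4 * m₀ + c ^ 2 + 4 * (|C| + ‖y‖ + ‖v‖ + 1) ^ 2) / (c ^ 2 * m₀) with hM_def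
  have hq : ∀ u, 0 < m u := fun u => hm₀.trans_le (hm u)
  have hsqrt : ∀ u, (Real.sqrt (m u))⁻¹ ≤ (Real.sqrt m₀)⁻¹ := fun u =>
    inv_anti₀ (Real.sqrt_pos.2 hm₀) (Real.sqrt_le_sqrt (hm u))
  have hdom : ∀ u : ℝ, ∀ s ∈ Metric.ball (0 : ℝ) 1, (‖y + s • v - X u‖ ^ 2 + m u)⁻¹ ≤ M * (1 + u ^ 2)⁻¹ := by
    intro u s hs
    rw [Metric.mem_ball, dist_zero_right, Real.norm_eq_abs] at hs
    refine inv_le_of_norm_sub_le hm₀ hm hc hXg (norm_nonneg v) y ?_ u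
    rw [add_sub_cancel_left, norm_smul, Real.norm_eq_abs]
    exact mul_le_of_le_one_left (norm_nonneg v) hs.le
  refine hasDerivAt_integral_of_dominated_loc_of_deriv_le (𝕜 := ℝ) (μ := volume) (x₀ := (0 : ℝ))
    (F := fun (s : ℝ) (u : ℝ) =>
      ((‖y + s • v - X u‖ ^ 2 + m u) ^ (3 / 2 : ℝ))⁻¹ • cross (deriv X u) (y + s • v - X u))
    (F' := fun (s : ℝ) (u : ℝ) =>
      (-3 * inner ℝ (y + s • v - X u) v * ((‖y + s • v - X u‖ ^ 2 + m u) ^ (5 / 2 : ℝ))⁻¹) •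
          cross (deriv X u) (y + s • v - X u) +
        ((‖y + s • v - X u‖ ^ 2 + m u) ^ (3 / 2 : ℝ))⁻¹ • cross (deriv X u) v)
    (bound := fun u => 4 * (Real.sqrt m₀)⁻¹ * (M * (1 + u ^ 2)⁻¹) * ‖v‖)
    (Metric.ball_mem_nhds (0 : ℝ) one_pos) ?_ ?_ ?_ ?_ ?_ ?_
  · exact Eventually.of_forall fun s => (continuous_integrand_at hm₀ hm hmc hX (y + s • v)).aestronglyMeasurable
  · refine (integrable_inv_one_add_sq.const_mul M).mono'
      (continuous_integrand_at hm₀ hm hmc hX _).aestronglyMeasurable (Eventually.of_forall fun u => ?_)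
    exact (norm_integrand_le (hq u) _ _ (hX1 u)).trans (hdom u 0 (Metric.mem_ball_self one_pos))
  · exact (continuous_deriv_integrand_at hm₀ hm hmc hX _ v).aestronglyMeasurable
  · refine Eventually.of_forall fun u s hs => ?_
    calc _ ≤ 4 * (Real.sqrt (m u))⁻¹ * (‖y + s • v - X u‖ ^ 2 + m u)⁻¹ * ‖v‖ :=
          norm_deriv_integrand_le (hq u) _ _ _ (hX1 u)
      _ ≤ 4 * (Real.sqrt m₀)⁻¹ * (M * (1 + u ^ 2)⁻¹) * ‖v‖ := by
          have h1 := hsqrt u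
          have h2 := hdom u s hs
          have h3 : 0 ≤ (‖y + s • v - X u‖ ^ 2 + m u)⁻¹ := inv_nonneg.2 (add_pos_of_nonneg_of_pos (sq_nonneg _) (hq u)).le
          have h4 : 0 ≤ (Real.sqrt m₀)⁻¹ := inv_nonneg.2 (Real.sqrt_nonneg _)
          gcongr
  · exact ((integrable_inv_one_add_sq.const_mul M).const_mul _).mul_const _
  · exact Eventually.of_forall fun u s _ => integrand_hasDerivAt_line (hq u) (deriv X u) y v (X u) s

/-- **Directional derivative of the matched-core Biot–Savart field**: at every `y`, in every direction `v`, the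
derivative integrand is Bochner integrable and
`d/ds F(y + s v)|_{s=0} = ∫ [(−3 ⟨y − X u, v⟩ K₅) • X′(u) × (y − X u) + K₃ • X′(u) × v] du`. [folklore] -/
theorem matchedBiotSavart_directionalDeriv {m : ℝ → ℝ} {m₀ c C : ℝ} {X : ℝ → EuclideanSpace ℝ (Fin 3)}
    (hm₀ : 0 < m₀) (hm : ∀ u, m₀ ≤ m u) (hmc : Continuous m) (hc : 0 < c) (hX : ContDiff ℝ 1 X)
    (hX1 : ∀ u, ‖deriv X u‖ ≤ 1) (hXg : ∀ u, c * |u| - C ≤ ‖X u‖) (y v : EuclideanSpace ℝ (Fin 3)) :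
    Integrable (fun u : ℝ =>
        (-3 * inner ℝ (y - X u) v * ((‖y - X u‖ ^ 2 + m u) ^ (5 / 2 : ℝ))⁻¹) • cross (deriv X u) (y - X u)
          + ((‖y - X u‖ ^ 2 + m u) ^ (3 / 2 : ℝ))⁻¹ • cross (deriv X u) v) ∧
      HasDerivAt (fun s : ℝ => ∫ u : ℝ,
          ((‖y + s • v - X u‖ ^ 2 + m u) ^ (3 / 2 : ℝ))⁻¹ • cross (deriv X u) (y + s • v - X u))
        (∫ u : ℝ,
          (-3 * inner ℝ (y - X u) v * ((‖y - X u‖ ^ 2 + m u) ^ (5 / 2 : ℝ))⁻¹) • cross (deriv X u) (y - X u)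
            + ((‖y - X u‖ ^ 2 + m u) ^ (3 / 2 : ℝ))⁻¹ • cross (deriv X u) v) 0 := by
  simpa only [zero_smul, add_zero] using directionalDeriv_key hm₀ hm hmc hc hX hX1 hXg y v

/-- **Explicit Fréchet derivative of the matched-core Biot–Savart field**: for every `y`, `v`,
`fderiv F y v = ∫ [(−3 ⟨y − X u, v⟩ K₅) • X′(u) × (y − X u) + K₃ • X′(u) × v] du`. [folklore] -/
theorem matchedBiotSavart_fderiv_apply_eq {m : ℝ → ℝ} {m₀ c C : ℝ} {X : ℝ → EuclideanSpace ℝ (Fin 3)}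
    (hm₀ : 0 < m₀) (hm : ∀ u, m₀ ≤ m u) (hmc : Continuous m) (hc : 0 < c) (hX : ContDiff ℝ 1 X)
    (hX1 : ∀ u, ‖deriv X u‖ ≤ 1) (hXg : ∀ u, c * |u| - C ≤ ‖X u‖) (y v : EuclideanSpace ℝ (Fin 3)) :
    fderiv ℝ (fun y : EuclideanSpace ℝ (Fin 3) => ∫ u : ℝ,
        ((‖y - X u‖ ^ 2 + m u) ^ (3 / 2 : ℝ))⁻¹ • cross (deriv X u) (y - X u)) y v =
      ∫ u : ℝ, ((-3 * ⟪y - X u, v⟫_ℝ * ((‖y - X u‖ ^ 2 + m u) ^ (5 / 2 : ℝ))⁻¹) • cross (deriv X u) (y - X u)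
        + ((‖y - X u‖ ^ 2 + m u) ^ (3 / 2 : ℝ))⁻¹ • cross (deriv X u) v) := by
  set F : EuclideanSpace ℝ (Fin 3) → EuclideanSpace ℝ (Fin 3) := fun y => ∫ u : ℝ,
    ((‖y - X u‖ ^ 2 + m u) ^ (3 / 2 : ℝ))⁻¹ • cross (deriv X u) (y - X u) with hF
  have hdiff : Differentiable ℝ F := matchedBiotSavart_differentiable hm₀ hm hmc hc hX hX1 hXg
  obtain ⟨-, hdir⟩ := matchedBiotSavart_directionalDeriv hm₀ hm hmc hc hX hX1 hXg y v
  have hpath : HasDerivAt (fun s : ℝ => y + s • v) v 0 := by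
    have h := ((hasDerivAt_id (0 : ℝ)).smul_const v).const_add y
    simpa using h
  have hchain : HasDerivAt (fun s : ℝ => F (y + s • v)) (fderiv ℝ F y v) 0 :=
    (hdiff y).hasFDerivAt.comp_hasDerivAt_of_eq (0 : ℝ) hpath (by simp)
  have hdir' : HasDerivAt (fun s : ℝ => F (y + s • v))
      (∫ u : ℝ, ((-3 * ⟪y - X u, v⟫_ℝ * ((‖y - X u‖ ^ 2 + m u) ^ (5 / 2 : ℝ))⁻¹) •
          cross (deriv X u) (y - X u) + ((‖y - X u‖ ^ 2 + m u) ^ (3 / 2 : ℝ))⁻¹ • cross (deriv X u) v)) 0 := by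
    simpa [hF] using hdir
  exact hchain.unique hdir'

end Summit.NavierStokesRegularity.NavierStokesRegularity.Theorems.MatchedKernel
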